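import Summits.HodgeConjecture.HodgeConjecture.Theses.PadicSemiregularLift
import Summits.HodgeConjecture.HodgeConjecture.Theses.SupersingularIsotypicLift
import Summits.HodgeConjecture.HodgeConjecture.Theses.GaloisSieve
import Summits.HodgeConjecture.HodgeConjecture.Theses.DerivedTorelliFermat

/-!
# `HodgeFermatVarieties` (stmt-HodgeConjecture-1334): the degree-`0` instance is vacuous; cross-route equivalences

Negative/support lemmas of the standing disprover of the crux
`Summit.HodgeConjecture.HodgeConjecture.Theses.PadicSemiregularLift.HodgeFermatVarieties`
(the Hodge conjecture for all complex Fermat hypersurfaces `Xⁿₘ : Σ xᵢᵐ = 0 ⊂ ℙⁿ⁺¹_ℂ`), all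
sorry-free and unconditional:

* `degree_zero_vacuous` — for `m = 0` the Fermat form `Σ xᵢ⁰ = n + 2` is a unit, `V₊(n + 2) = ∅`, so a
  reduced `X` closed-immersed onto it is EMPTY, while `IsSmoothProjective n X` (geometric
  irreducibility over the point `Spec ℂ`) makes `X` non-empty: the two hypotheses of the crux are
  contradictory at `m = 0`. Hence the extra hypothesis `0 < m` carried by the sibling item
  `GaloisSieve.FermatHC` (stmt-HodgeConjecture-13238) is redundant;
* `iff_galoisSieve_fermatHC`, `iff_supersingularIsotypicLift_fermatHodge` — the crux is EQUIVALENT to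
  `GaloisSieve.FermatHC` (stmt-13238) and to `SupersingularIsotypicLift.FermatHodge` (stmt-3051), so a
  proof or refutation of any one of the three settles the other two;
* `fermatFourfoldThirtyThree_of` — it implies `DerivedTorelliFermat.FermatFourfoldThirtyThree`
  (stmt-11125), the first instance open in print (da Silva 2021: `(P₃₃)` fails);
* `of_hodgeConjecture` — and it is implied by the summit (a refutation would refute HC itself).

Refuter refuter-cdisprove-stmt-HodgeConjecture-1334-0, 2026-08-15 (full analysis:
`Cruxes/HodgeFermatVarieties/Disproof.lean`).
-/

namespace Summit.HodgeConjecture.HodgeConjecture.Theorems.HodgeFermatVarietiesNegative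

open CategoryTheory AlgebraicGeometry
open Literature.AlgebraicGeometry.Motives Literature.AlgebraicGeometry.HodgeTheory
open Summit.HodgeConjecture.HodgeConjecture.Theses.PadicSemiregularLift (HodgeFermatVarieties)

/-- At `m = 0` the Fermat form is the constant `n + 2`. [folklore] -/
theorem fermatPolynomial_zero (n : ℕ) :
    fermatPolynomial ℂ n 0 = ((n + 2 : ℕ) : MvPolynomial (Fin (n + 2)) ℂ) := by
  simp only [fermatPolynomial, pow_zero, Finset.sum_const, Finset.card_univ, Fintype.card_fin,
    nsmul_eq_mul, mul_one]

/-- … hence a unit of `ℂ[x₀, …, x_{n+1}]`. [folklore] -/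
theorem isUnit_fermatPolynomial_zero (n : ℕ) : IsUnit (fermatPolynomial ℂ n 0) := by
  rw [fermatPolynomial_zero, ← map_natCast (algebraMap ℂ (MvPolynomial (Fin (n + 2)) ℂ))]
  refine IsUnit.map _ ?_
  rw [isUnit_iff_ne_zero]
  exact_mod_cast Nat.succ_ne_zero (n + 1)

/-- `IsFermatVariety n 0 X` forces `X = ∅`: no relevant homogeneous prime contains a unit, so the
image `V₊(n + 2)` of the closed immersion is empty. [folklore] -/
theorem isEmpty_of_isFermatVariety_zero {n : ℕ} {X : SchemeOver ℂ} (hF : IsFermatVariety n 0 X) :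
    IsEmpty ↥X.left := by
  letI := MvPolynomial.gradedAlgebra (σ := Fin (n + 1 + 1)) (R := ℂ)
  obtain ⟨_, ι, _, hrange⟩ := hF
  refine ⟨fun x ↦ ?_⟩
  have hx : ι.left.base x ∈ Set.range ι.left.base := ⟨x, rfl⟩
  rw [hrange] at hx
  have hx' : fermatPolynomial ℂ n 0 ∈
      (ι.left.base x : ProjectiveSpectrum (MvPolynomial.homogeneousSubmodule (Fin (n + 1 + 1)) ℂ)).asHomogeneousIdeal :=
    Set.singleton_subset_iff.1 ((ProjectiveSpectrum.mem_zeroLocus _ _ _).1 hx)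
  exact (ι.left.base x : ProjectiveSpectrum _).isPrime.ne_top
    (Ideal.eq_top_of_isUnit_mem _ hx' (isUnit_fermatPolynomial_zero n))

/-- A smooth projective `ℂ`-scheme is non-empty (geometrically irreducible over a one-point base).
[folklore] -/
theorem nonempty_of_isSmoothProjective {n : ℕ} {X : SchemeOver ℂ} (hX : IsSmoothProjective n X) :
    Nonempty ↥X.left := by
  have := hX.geometricallyIrreducible
  have : IrreducibleSpace ↥X.left := GeometricallyIrreducible.irreducibleSpace_of_subsingleton X.hom
  infer_instance

/-- **The `m = 0` instance of `HodgeFermatVarieties` is vacuous**: its hypotheses are contradictory.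
[folklore] -/
theorem degree_zero_vacuous {n : ℕ} {X : SchemeOver ℂ} (hF : IsFermatVariety n 0 X)
    (hX : IsSmoothProjective n X) : False :=
  (isEmpty_of_isFermatVariety_zero hF).false (nonempty_of_isSmoothProjective hX).some

/-- The crux is equivalent to `GaloisSieve.FermatHC` (stmt-HodgeConjecture-13238): the latter's extra
hypothesis `0 < m` is redundant. [folklore] -/
theorem iff_galoisSieve_fermatHC :
    HodgeFermatVarieties ↔ Summit.HodgeConjecture.HodgeConjecture.Theses.GaloisSieve.FermatHC := by
  refine ⟨fun h n m X _ hF hX ↦ h n m X hF hX, fun h n m X hF hX ↦ ?_⟩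
  rcases Nat.eq_zero_or_pos m with rfl | hm
  · exact (degree_zero_vacuous hF hX).elim
  · exact h n m X hm hF hX

/-- The crux is literally `SupersingularIsotypicLift.FermatHodge` (stmt-HodgeConjecture-3051), hypotheses
swapped. [folklore] -/
theorem iff_supersingularIsotypicLift_fermatHodge :
    HodgeFermatVarieties ↔ Summit.HodgeConjecture.HodgeConjecture.Theses.SupersingularIsotypicLift.FermatHodge :=
  ⟨fun h _ _ _ hX hF ↦ h _ _ _ hF hX, fun h _ _ _ hF hX ↦ h hX hF⟩

/-- The crux implies the degree-`33` fourfold item `DerivedTorelliFermat.FermatFourfoldThirtyThree`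
(stmt-HodgeConjecture-11125). [folklore] -/
theorem fermatFourfoldThirtyThree_of (h : HodgeFermatVarieties) :
    Summit.HodgeConjecture.HodgeConjecture.Theses.DerivedTorelliFermat.FermatFourfoldThirtyThree :=
  fun X hF hX ↦ h 4 33 X hF hX

/-- The summit implies the crux (so refuting the crux refutes the Hodge conjecture). [folklore] -/
theorem of_hodgeConjecture (h : _root_.HodgeConjecture) : HodgeFermatVarieties :=
  fun _ _ _ _ hX ↦ h hX

end Summit.HodgeConjecture.HodgeConjecture.Theorems.HodgeFermatVarietiesNegative
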